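import Literature.MathematicalPhysics.KineticTheory.LangevinChainTheorem51
import Mathlib.Probability.Distributions.Exponential
import Mathlib.Analysis.SpecialFunctions.ImproperIntegrals
import Mathlib.MeasureTheory.Integral.Prod
import HarnessLib

/-!
# The resolvent kernel of the pinned-chain transition semigroup

Trunk T-KINETIC (Literature/MathematicalPhysics/KineticTheory). For a Markov semigroup `(P_t)` and a
rate `r > 0`, the **resolvent kernel** `R_r(z, ·) = ∫₀^∞ r e^{-rt} P_t(z, ·) dt` is the law of the
process started at `z` and observed at an independent exponential time of rate `r` (as an operator
`R_r = r (r - L)⁻¹`: Ethier–Kurtz, Ch. 1 §2, resolvents as Laplace transforms of semigroups). This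
file builds it for the transition semigroup `pinnedChainSemigroup` of the pinned anharmonic chain
(`LangevinChainDynkin.lean`) WITHOUT new definitions — the kernel is the Mathlib composite
`K ∘ₖ (Kernel.const _ (expMeasure r) ×ₖ Kernel.id)` of the time-extended kernel
`K (t, z) = P_{t⁺}(z, ·)` with Mathlib's exponential law `expMeasure r` — and
`pinnedChain_exists_resolventKernel` packages it existentially with the three properties consumed by
the velocity-flip route (the chain embedded at the flip times):
(i) the **resolvent (Dynkin) identity** `∫ Lf dR_r(z, ·) = r (∫ f dR_r(z, ·) - f(z))` on `C_c^∞`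
(`LangevinChainSemigroup.integral_generator_comp_const_prod_id`, for any Langevin-chain semigroup
with `C¹` potentials: Dynkin's identity integrated against `r e^{-rt} dt` and the Fubini computation
`integral_exp_mul_intervalIntegral_eq`); (ii) the **Feller property**
(`LangevinChainSemigroup.continuous_integral_comp_const_prod_id`, dominated convergence); (iii) a
**contracting Lyapunov bound** `∫ e^{θH} dR_r(z, ·) ≤ a e^{θH(z)} + b` with `a < 1`, `b < ∞`
(`0 < θ < 1/max(T_L,T_R)`, `lam > 0`, `N ≥ 2`): CEHR Thm 5.1 in the tree
(`pinnedChain_lintegral_exp_hamiltonian_small`, contraction `1/2` at every `t* > 0`) and (3.4) give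
`P_t e^{θH} ≤ e^{Ct*} e^{θH} + B` for all `t`, and `≤ ½ e^{Ct*} e^{θH} + B'` for `t ≥ t*`
((3.5)–(3.6), `MarkovSemigroup.lintegral_kernel_le_of_lyapunov`); averaging over the exponential
time (`lintegral_comp_const_prod_id_le`, `Exp_r[0, t*) ≤ r t*`) gives `a ≤ e^{Ct*}(r t* + ½) ≤ 5/7`
for `t* = 1/(8(C + r + 1))`, `C = θγ(T_L + T_R)`. Deliberately NOT here: the resolvent equation,
strong continuity, the domain of the generator. References: N. Cuneo, J.-P. Eckmann, M. Hairer,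
L. Rey-Bellet, *Non-equilibrium steady states for networks of oscillators*, EJP 23 (2018) no. 55,
§3 eq. (3.4)–(3.6), Thm 5.1, Rem 5.2; S. N. Ethier, T. G. Kurtz, *Markov Processes* (1986), Ch. 1 §2.
-/

noncomputable section

open MeasureTheory ProbabilityTheory Filter Topology Set
open scoped NNReal ENNReal ContDiff BoundedContinuousFunction

namespace Literature.MathematicalPhysics.KineticTheory.HeatConduction

open Literature.Probability.Process OscillatorChain

/-! ### Averaging a kernel over a random time; the exponential law -/

section Averaging

variable {X Y : Type*} [MeasurableSpace X] [MeasurableSpace Y]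

/-- **Averaging a time-dependent kernel over a law `ρ` of times** (the composite
`K ∘ₖ (const ρ ×ₖ id)` sends `z` to `∫ K(t, z) ρ(dt)`), Lebesgue form:
`∫⁻ V d(K ∘ₖ (const ρ ×ₖ id))(z) = ∫⁻ (∫⁻ V dK(t, z)) ρ(dt)` (Tonelli). [folklore] -/
theorem lintegral_comp_const_prod_id (K : Kernel (ℝ × X) Y) [IsSFiniteKernel K] (ρ : Measure ℝ)
    [SFinite ρ] (z : X) {V : Y → ℝ≥0∞} (hV : Measurable V) :
    ∫⁻ y, V y ∂((K ∘ₖ (Kernel.const X ρ ×ₖ Kernel.id)) z) =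
      ∫⁻ t, ∫⁻ y, V y ∂(K (t, z)) ∂ρ := by
  rw [Kernel.lintegral_comp _ _ _ hV, Kernel.lintegral_prod_id (hV.lintegral_kernel (κ := K)),
    Kernel.const_apply]

/-- **Averaging a time-dependent Markov kernel over a probability law `ρ` of times**, Bochner form:
`∫ g d(K ∘ₖ (const ρ ×ₖ id))(z) = ∫ (∫ g dK(t, z)) ρ(dt)` for bounded measurable `g`. [folklore] -/
theorem integral_comp_const_prod_id (K : Kernel (ℝ × X) Y) [IsMarkovKernel K] (ρ : Measure ℝ)
    [IsProbabilityMeasure ρ] (z : X) {g : Y → ℝ} (hg : StronglyMeasurable g) {C : ℝ}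
    (hC : ∀ y, ‖g y‖ ≤ C) :
    ∫ y, g y ∂((K ∘ₖ (Kernel.const X ρ ×ₖ Kernel.id)) z) = ∫ t, ∫ y, g y ∂(K (t, z)) ∂ρ := by
  have hint : Integrable g ((K ∘ₖ (Kernel.const X ρ ×ₖ Kernel.id)) z) :=
    (integrable_const C).mono' hg.aestronglyMeasurable (Eventually.of_forall hC)
  rw [Kernel.integral_comp hint, Kernel.prod_apply, Kernel.const_apply, Kernel.id_apply,
    Measure.prod_dirac, integral_map (by fun_prop)
      (hg.integral_kernel (κ := K)).aestronglyMeasurable]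

/-- **Two-regime averaging of a Lyapunov bound.** If `∫⁻ V dK(t, z) ≤ c₁ V(z) + B₁` for all times
`t` and `≤ c₂ V(z) + B₂` for `t ≥ t*`, then averaging over a probability law `ρ` of times gives
`∫⁻ V d(K ∘ₖ (const ρ ×ₖ id))(z) ≤ (c₁ ρ[t < t*] + c₂) V(z) + (B₁ + B₂)`. [folklore] -/
theorem lintegral_comp_const_prod_id_le (K : Kernel (ℝ × X) X) [IsSFiniteKernel K] (ρ : Measure ℝ)
    [IsProbabilityMeasure ρ] (z : X) {V : X → ℝ≥0∞} (hV : Measurable V) (tstar : ℝ)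
    {c₁ B₁ c₂ B₂ : ℝ≥0∞} (h₁ : ∀ t, ∫⁻ y, V y ∂(K (t, z)) ≤ c₁ * V z + B₁)
    (h₂ : ∀ t, tstar ≤ t → ∫⁻ y, V y ∂(K (t, z)) ≤ c₂ * V z + B₂) :
    ∫⁻ y, V y ∂((K ∘ₖ (Kernel.const X ρ ×ₖ Kernel.id)) z) ≤
      (c₁ * ρ (Iio tstar) + c₂) * V z + (B₁ + B₂) := by
  rw [lintegral_comp_const_prod_id K ρ z hV]
  have hpt : ∀ t, ∫⁻ y, V y ∂(K (t, z)) ≤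
      (Iio tstar).indicator (fun _ => c₁ * V z + B₁) t + (c₂ * V z + B₂) := fun t => by
    by_cases ht : t < tstar
    · rw [indicator_of_mem (mem_Iio.2 ht)]; exact (h₁ t).trans le_self_add
    · rw [indicator_of_notMem (fun h => ht (mem_Iio.1 h)), zero_add]; exact h₂ t (not_lt.1 ht)
  calc ∫⁻ t, ∫⁻ y, V y ∂(K (t, z)) ∂ρ
      ≤ ∫⁻ t, ((Iio tstar).indicator (fun _ => c₁ * V z + B₁) t + (c₂ * V z + B₂)) ∂ρ :=
        lintegral_mono hpt
    _ = c₁ * ρ (Iio tstar) * V z + B₁ * ρ (Iio tstar) + (c₂ * V z + B₂) := by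
        rw [lintegral_add_right _ measurable_const, lintegral_indicator_const measurableSet_Iio,
          lintegral_const, measure_univ, mul_one]; ring
    _ ≤ c₁ * ρ (Iio tstar) * V z + B₁ * 1 + (c₂ * V z + B₂) := by gcongr; exact prob_le_one
    _ = (c₁ * ρ (Iio tstar) + c₂) * V z + (B₁ + B₂) := by ring

end Averaging

section ExpLaw

/-- **Integration against the exponential law** (Mathlib's `expMeasure r`, rate `r > 0`):
`∫ g dExp_r = ∫₀^∞ r e^{-rt} g(t) dt` for every `g` (both sides are junk together). [folklore] -/
theorem integral_expMeasure_eq_integral_Ioi {r : ℝ} (hr : 0 < r) (g : ℝ → ℝ) :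
    ∫ t, g t ∂(expMeasure r) = ∫ t in Ioi 0, r * Real.exp (-(r * t)) * g t := by
  have hm : Measurable (exponentialPDF r) := (measurable_exponentialPDFReal r).ennreal_ofReal
  rw [show expMeasure r = volume.withDensity (exponentialPDF r) from rfl,
    integral_withDensity_eq_integral_toReal_smul hm (Eventually.of_forall fun _ => ENNReal.ofReal_lt_top)]
  have h2 : (fun t => (exponentialPDF r t).toReal • g t) =
      (Ici (0:ℝ)).indicator (fun t => r * Real.exp (-(r * t)) * g t) := by
    funext t
    simp only [exponentialPDF_eq, indicator_apply, mem_Ici]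
    split_ifs with ht
    · rw [ENNReal.toReal_ofReal (by positivity), smul_eq_mul]
    · simp
  rw [h2, integral_indicator measurableSet_Ici, integral_Ici_eq_integral_Ioi]

/-- The exponential law gives `(-∞, a)` mass `1 - e^{-ra} ≤ ra` for `a ≥ 0`. [folklore] -/
theorem expMeasure_Iio_le {r : ℝ} (hr : 0 < r) {a : ℝ} (ha : 0 ≤ a) :
    expMeasure r (Iio a) ≤ ENNReal.ofReal (r * a) := by
  haveI := isProbabilityMeasure_expMeasure hr
  calc expMeasure r (Iio a) ≤ expMeasure r (Iic a) := measure_mono Iio_subset_Iic_self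
    _ = ENNReal.ofReal (cdf (expMeasure r) a) := (ofReal_cdf _ a).symm
    _ ≤ ENNReal.ofReal (r * a) := ENNReal.ofReal_le_ofReal (by
        rw [cdf_expMeasure_eq hr, if_pos ha]; linarith [Real.add_one_le_exp (-(r * a))])

/-- **`∫₀^∞ r e^{-rt} (∫₀ᵗ ψ(s) ds) dt = ∫₀^∞ e^{-rs} ψ(s) ds` for bounded measurable `ψ`** (the
mean of `∫₀^τ ψ` for an exponential time `τ` of rate `r`): Fubini on `{0 < s ≤ t}` (the integrand is
dominated by `‖ψ‖_∞ r e^{-rt/2} e^{-rs/2}`) and `∫_s^∞ r e^{-rt} dt = e^{-rs}`. [folklore] -/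
theorem integral_exp_mul_intervalIntegral_eq {ψ : ℝ → ℝ} (hψ : Measurable ψ) {C : ℝ}
    (hC : ∀ s, ‖ψ s‖ ≤ C) {r : ℝ} (hr : 0 < r) :
    ∫ t in Ioi 0, r * Real.exp (-(r * t)) * ∫ s in (0:ℝ)..t, ψ s =
      ∫ s in Ioi 0, Real.exp (-(r * s)) * ψ s := by
  set G : ℝ × ℝ → ℝ := {p : ℝ × ℝ | p.2 ≤ p.1}.indicator fun p => r * Real.exp (-(r * p.1)) * ψ p.2
    with hG
  have hGm : Measurable G :=
    (Measurable.indicator (by fun_prop) (measurableSet_le measurable_snd measurable_fst))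
  -- the inner integral as an integral of `G (t, ·)` over `(0, ∞)`
  have h1 : EqOn (fun t => r * Real.exp (-(r * t)) * ∫ s in (0:ℝ)..t, ψ s)
      (fun t => ∫ s in Ioi 0, G (t, s)) (Ioi 0) := by
    intro t ht
    simp only
    rw [intervalIntegral.integral_of_le (le_of_lt ht), ← integral_const_mul, ← Ioi_inter_Iic,
      ← setIntegral_indicator measurableSet_Iic]
    refine setIntegral_congr_fun measurableSet_Ioi fun s _ => ?_
    simp only [hG, indicator_apply, mem_Iic, mem_setOf_eq]
  -- the `t`-integral for fixed `s > 0`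
  have h3 : EqOn (fun s => ∫ t in Ioi 0, G (t, s)) (fun s => Real.exp (-(r * s)) * ψ s) (Ioi 0) := by
    intro s hs
    simp only
    have e : (fun t => G (t, s)) = (Ici s).indicator (fun t => r * Real.exp (-(r * t)) * ψ s) := by
      funext t; simp only [hG, indicator_apply, mem_Ici, mem_setOf_eq]
    rw [e, setIntegral_indicator measurableSet_Ici, inter_eq_right.2 (Ici_subset_Ioi.2 hs),
      integral_Ici_eq_integral_Ioi, integral_mul_const, integral_const_mul]
    have h4 : ∫ t in Ioi s, Real.exp (-(r * t)) = -Real.exp (-(r * s)) / -r := by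
      simpa only [neg_mul] using integral_exp_mul_Ioi (neg_lt_zero.2 hr) s
    rw [h4]; field_simp
  -- integrability on the product (dominated by `|C| r e^{-rt/2} e^{-rs/2}`)
  have hint : Integrable (Function.uncurry fun t s => G (t, s))
      ((volume.restrict (Ioi (0:ℝ))).prod (volume.restrict (Ioi (0:ℝ)))) := by
    have hH : Integrable
        (fun p : ℝ × ℝ => (|C| * r * Real.exp (-(r / 2) * p.1)) * Real.exp (-(r / 2) * p.2))
        ((volume.restrict (Ioi (0:ℝ))).prod (volume.restrict (Ioi (0:ℝ)))) :=
      Integrable.mul_prod ((exp_neg_integrableOn_Ioi 0 (half_pos hr)).const_mul (|C| * r))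
        (exp_neg_integrableOn_Ioi 0 (half_pos hr))
    refine hH.mono' hGm.aestronglyMeasurable (Eventually.of_forall fun p => ?_)
    change ‖G p‖ ≤ _
    rw [hG, norm_indicator_eq_indicator_norm]
    refine indicator_apply_le' (fun hp => ?_) (fun _ => by positivity)
    replace hp : p.2 ≤ p.1 := hp
    rw [norm_mul, norm_mul, Real.norm_of_nonneg hr.le, Real.norm_of_nonneg (Real.exp_pos _).le]
    have e1 : Real.exp (-(r * p.1)) ≤ Real.exp (-(r / 2) * p.1) * Real.exp (-(r / 2) * p.2) := by
      rw [← Real.exp_add]; exact Real.exp_le_exp.2 (by nlinarith)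
    have e2 : ‖ψ p.2‖ ≤ |C| := (hC _).trans (le_abs_self C)
    calc r * Real.exp (-(r * p.1)) * ‖ψ p.2‖
        ≤ r * (Real.exp (-(r / 2) * p.1) * Real.exp (-(r / 2) * p.2)) * |C| := by gcongr
      _ = |C| * r * Real.exp (-(r / 2) * p.1) * Real.exp (-(r / 2) * p.2) := by ring
  calc ∫ t in Ioi 0, r * Real.exp (-(r * t)) * ∫ s in (0:ℝ)..t, ψ s
      = ∫ t in Ioi 0, ∫ s in Ioi 0, G (t, s) := setIntegral_congr_fun measurableSet_Ioi h1
    _ = ∫ s in Ioi 0, ∫ t in Ioi 0, G (t, s) := integral_integral_swap hint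
    _ = ∫ s in Ioi 0, Real.exp (-(r * s)) * ψ s := setIntegral_congr_fun measurableSet_Ioi h3

end ExpLaw

/-! ### The resolvent of a Langevin-chain semigroup -/

namespace LangevinChainSemigroup

variable {P : OscillatorChain} {N : ℕ} {T_L T_R : ℝ} (S : LangevinChainSemigroup P N T_L T_R)
  (K : Kernel (ℝ × PhaseSpace N) (PhaseSpace N))
  (hK : ∀ (t : ℝ) (z : PhaseSpace N), K (t, z) = S.kernel t.toNNReal z)
include hK

/-- **Past `t*`, one Lyapunov step sharpens a uniform orbit bound**: if `P_{t*} V ≤ a V + b` and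
`P_t V ≤ c V + B` for all `t`, then `P_t V = P_{t*}(P_{t-t*} V) ≤ c a V + (c b + B)` for `t ≥ t*`
(Chapman–Kolmogorov), stated for the time-extended kernel `K (t, z) = P_{t⁺}(z, ·)`. [folklore] -/
theorem lintegral_kernel_le_of_tstar_le {V : PhaseSpace N → ℝ≥0∞} (hV : Measurable V) {tstar : ℝ≥0}
    {a b c B : ℝ≥0∞} (hlyap : ∀ x, ∫⁻ y, V y ∂(S.kernel tstar x) ≤ a * V x + b)
    (hunif : ∀ (t : ℝ≥0) x, ∫⁻ y, V y ∂(S.kernel t x) ≤ c * V x + B) {t : ℝ}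
    (ht : (tstar : ℝ) ≤ t) (x : PhaseSpace N) :
    ∫⁻ y, V y ∂(K (t, x)) ≤ c * a * V x + (c * b + B) := by
  obtain ⟨u, hu⟩ : ∃ u : ℝ≥0, t.toNNReal = tstar + u :=
    exists_add_of_le (show tstar ≤ t.toNNReal from by
      rw [← NNReal.coe_le_coe, Real.coe_toNNReal _ (tstar.coe_nonneg.trans ht)]; exact ht)
  rw [hK, hu, S.kernel_add, Kernel.lintegral_comp _ _ _ hV]
  calc ∫⁻ y, ∫⁻ w, V w ∂(S.kernel u y) ∂(S.kernel tstar x)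
      ≤ ∫⁻ y, (c * V y + B) ∂(S.kernel tstar x) := lintegral_mono fun y => hunif u y
    _ = c * ∫⁻ y, V y ∂(S.kernel tstar x) + B := by
        rw [lintegral_add_right _ measurable_const, lintegral_const_mul _ hV, lintegral_const,
          measure_univ, mul_one]
    _ ≤ c * (a * V x + b) + B := by gcongr; exact hlyap x
    _ = c * a * V x + (c * b + B) := by ring

/-- **Feller property of the time-averaged kernel**: if every `P_t` maps bounded continuous
functions to continuous ones, so does `K ∘ₖ (const ρ ×ₖ id)` for any probability law `ρ` of times
(`z ↦ ∫ (P_{t⁺} g)(z) ρ(dt)`, dominated convergence with the bound `‖g‖_∞`). [folklore] -/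
theorem continuous_integral_comp_const_prod_id [IsMarkovKernel K] (ρ : Measure ℝ)
    [IsProbabilityMeasure ρ] (hF : ∀ (t : ℝ≥0) (g : PhaseSpace N →ᵇ ℝ), Continuous (S.act t g))
    (g : PhaseSpace N →ᵇ ℝ) :
    Continuous fun z => ∫ y, g y ∂((K ∘ₖ (Kernel.const _ ρ ×ₖ Kernel.id)) z) := by
  have hg_bd : ∀ y, ‖g y‖ ≤ ‖g‖ := fun y => g.norm_coe_le_norm y
  have h1 : (fun z => ∫ y, g y ∂((K ∘ₖ (Kernel.const _ ρ ×ₖ Kernel.id)) z)) =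
      fun z => ∫ t, ∫ y, g y ∂(K (t, z)) ∂ρ := by
    funext z; exact integral_comp_const_prod_id K ρ z g.continuous.stronglyMeasurable hg_bd
  rw [h1]
  have hsm : StronglyMeasurable fun p : ℝ × PhaseSpace N => ∫ y, g y ∂(K p) :=
    g.continuous.stronglyMeasurable.integral_kernel (κ := K)
  refine continuous_of_dominated (bound := fun _ => ‖g‖) (fun z => ?_)
    (fun z => Eventually.of_forall fun t => ?_) (integrable_const _) (Eventually.of_forall fun t => ?_)
  · exact (hsm.comp_measurable (measurable_id.prodMk measurable_const)).aestronglyMeasurable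
  · exact (norm_integral_le_of_norm_le_const (Eventually.of_forall hg_bd)).trans (by simp)
  · have : (fun z => ∫ y, g y ∂(K (t, z))) = S.act t.toNNReal g := by
      funext z; rw [hK, act_apply]
    rw [this]; exact hF _ g

/-- **The resolvent identity** for a Langevin-chain semigroup with `C¹` potentials: for `r > 0` and
`f ∈ C_c^∞` the resolvent kernel `R_r = K ∘ₖ (const Exp_r ×ₖ id)` (`R_r(z, ·) = ∫₀^∞ r e^{-rt}
P_t(z, ·) dt`) satisfies `∫ Lf dR_r(z, ·) = r (∫ f dR_r(z, ·) - f(z))`, i.e. `R_r L = r (R_r - 1)` on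
`C_c^∞`: Dynkin's identity (the field `dynkin`; `Lf` is bounded and continuous) integrated against
`r e^{-rt} dt`, and `integral_exp_mul_intervalIntegral_eq`. [folklore] -/
theorem integral_generator_comp_const_prod_id [IsMarkovKernel K] (hU : ContDiff ℝ 1 P.U)
    (hV : ContDiff ℝ 1 P.V) {r : ℝ} (hr : 0 < r) {f : PhaseSpace N → ℝ} (hf : ContDiff ℝ ∞ f)
    (hfc : HasCompactSupport f) (z : PhaseSpace N) :
    ∫ y, P.generator N T_L T_R f y ∂((K ∘ₖ (Kernel.const _ (expMeasure r) ×ₖ Kernel.id)) z) =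
      r * (∫ y, f y ∂((K ∘ₖ (Kernel.const _ (expMeasure r) ×ₖ Kernel.id)) z) - f z) := by
  haveI := isProbabilityMeasure_expMeasure hr
  set ρ := expMeasure r with hρ
  set Lf := P.generator N T_L T_R f with hLf
  have hf2 : ContDiff ℝ 2 f := hf.of_le (by norm_cast)
  have hLc : Continuous Lf := P.continuous_generator hU hV N T_L T_R hf2
  obtain ⟨CL, hCL⟩ := P.exists_bound_generator hU hV N T_L T_R hf2 hfc
  obtain ⟨Cf, hCf⟩ : ∃ C, ∀ x, ‖f x‖ ≤ C := hf.continuous.bounded_above_of_compact_support hfc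
  set ψ : ℝ → ℝ := fun t => ∫ y, Lf y ∂(K (t, z)) with hψ
  have hKm : ∀ {g : PhaseSpace N → ℝ}, Continuous g →
      StronglyMeasurable fun t : ℝ => ∫ y, g y ∂(K (t, z)) := fun hg =>
    (hg.stronglyMeasurable.integral_kernel (κ := K)).comp_measurable
      (measurable_id.prodMk measurable_const)
  have hKb : ∀ {g : PhaseSpace N → ℝ} {C : ℝ}, (∀ x, ‖g x‖ ≤ C) →
      ∀ t, ‖∫ y, g y ∂(K (t, z))‖ ≤ C := fun {g C} hg t =>
    (norm_integral_le_of_norm_le_const (Eventually.of_forall hg)).trans (by simp)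
  -- Dynkin's identity along the orbit of `z`
  have hD : ∀ t : ℝ, 0 < t → ∫ y, f y ∂(K (t, z)) - f z = ∫ s in (0:ℝ)..t, ψ s := fun t ht => by
    simpa only [hψ, hK, Real.coe_toNNReal _ ht.le] using S.dynkin f hf hfc t.toNNReal z
  have hL : ∫ y, Lf y ∂((K ∘ₖ (Kernel.const _ ρ ×ₖ Kernel.id)) z) =
      r * ∫ t in Ioi 0, Real.exp (-(r * t)) * ψ t := by
    rw [integral_comp_const_prod_id K ρ z hLc.stronglyMeasurable hCL,
      integral_expMeasure_eq_integral_Ioi hr, ← integral_const_mul]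
    refine setIntegral_congr_fun measurableSet_Ioi fun t _ => ?_
    simp only [hψ]; ring
  have hR : ∫ y, f y ∂((K ∘ₖ (Kernel.const _ ρ ×ₖ Kernel.id)) z) - f z =
      ∫ t in Ioi 0, r * Real.exp (-(r * t)) * ∫ s in (0:ℝ)..t, ψ s := by
    rw [integral_comp_const_prod_id K ρ z hf.continuous.stronglyMeasurable hCf]
    have hφi : Integrable (fun t => ∫ y, f y ∂(K (t, z))) ρ := (integrable_const Cf).mono'
      (hKm hf.continuous).aestronglyMeasurable (Eventually.of_forall (hKb hCf))
    have e1 : ∫ t, ∫ y, f y ∂(K (t, z)) ∂ρ - f z = ∫ t, (∫ y, f y ∂(K (t, z)) - f z) ∂ρ := by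
      rw [integral_sub hφi (integrable_const _), integral_const, probReal_univ, one_smul]
    rw [e1, integral_expMeasure_eq_integral_Ioi hr]
    refine setIntegral_congr_fun measurableSet_Ioi fun t ht => ?_
    rw [hD t ht]
  rw [hL, hR, integral_exp_mul_intervalIntegral_eq (hKm hLc).measurable (hKb hCL) hr]

end LangevinChainSemigroup

/-! ### The resolvent kernel of the pinned chain -/

section PinnedChain

variable {ω₂ lam β γ : ℝ} {N : ℕ} {T_L T_R : ℝ}

/-- **Resolvent kernel of the pinned-chain transition semigroup** (`ω₂, lam, β, γ > 0`, `N ≥ 2`,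
`T_L, T_R > 0`, rate `r > 0`, `0 < θ < 1/max(T_L, T_R)`): there is a Markov kernel `R` on phase
space — namely `R(z, ·) = ∫₀^∞ r e^{-rt} P_t(z, ·) dt` for the transition semigroup
`pinnedChainSemigroup` of the SDE (2.2) — with (i) `∫ Lf dR(z, ·) = r (∫ f dR(z, ·) - f(z))` for
every `f ∈ C_c^∞` (resolvent identity, `L = OscillatorChain.generator`, the generator (3.2));
(ii) `z ↦ ∫ g dR(z, ·)` continuous for bounded continuous `g` (Feller); (iii) the CONTRACTING
Lyapunov bound `∫ e^{θH} dR(z, ·) ≤ a e^{θH(z)} + b`, `a < 1`, `b < ∞` (CEHR Thm 5.1 with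
contraction `1/2` at `t* = 1/(8(C + r + 1))`, `C = θγ(T_L + T_R)`, (3.4) on `[0, t*)`, the
iteration (3.5)–(3.6), averaged over the exponential time: `a ≤ e^{Ct*}(r t* + 1/2) ≤ 5/7`). This
is the one-step kernel, between two flips, of the chain embedded at the flip times of the
velocity-flip model at flip rate `r = Nε`.
[cite: CuneoEckmannHairerReyBellet2018, Thm 5.1, Rem 5.2 and §3 eq. (3.4)–(3.6)] -/
theorem pinnedChain_exists_resolventKernel (hω : 0 < ω₂) (hl : 0 < lam) (hβ : 0 < β) (hγ : 0 < γ)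
    (hN : 1 < N) (hTL : 0 < T_L) (hTR : 0 < T_R) {r : ℝ} (hr : 0 < r)
    {θ : ℝ} (hθ : 0 < θ) (hθ' : θ < 1 / max T_L T_R) :
    ∃ R : Kernel (PhaseSpace N) (PhaseSpace N), IsMarkovKernel R ∧
      (∀ f : PhaseSpace N → ℝ, ContDiff ℝ ∞ f → HasCompactSupport f → ∀ z : PhaseSpace N,
        ∫ y, (pinnedChain ω₂ lam β γ).generator N T_L T_R f y ∂(R z) = r * (∫ y, f y ∂(R z) - f z)) ∧
      (∀ g : PhaseSpace N →ᵇ ℝ, Continuous fun z => ∫ y, g y ∂(R z)) ∧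
      ∃ a b : ℝ≥0∞, a < 1 ∧ b ≠ ⊤ ∧ ∀ z : PhaseSpace N,
          ∫⁻ y, ENNReal.ofReal (Real.exp (θ * (pinnedChain ω₂ lam β γ).hamiltonian N y)) ∂(R z) ≤
            a * ENNReal.ofReal (Real.exp (θ * (pinnedChain ω₂ lam β γ).hamiltonian N z)) + b := by
  have hN0 : 0 < N := by omega
  set P := pinnedChain ω₂ lam β γ
  set Sg := pinnedChainSemigroup hω hl.le hβ.le hγ.le hN0 hTL.le hTR.le
  haveI := isProbabilityMeasure_expMeasure hr
  set ρ := expMeasure r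
  let K : Kernel (ℝ × PhaseSpace N) (PhaseSpace N) := ⟨fun p => Sg.kernel p.1.toNNReal p.2,
    Measurable.comp (g := fun q : ℝ≥0 × PhaseSpace N => Sg.kernel q.1 q.2)
      (f := fun p : ℝ × PhaseSpace N => (p.1.toNNReal, p.2)) Sg.measurable_kernel (by fun_prop)⟩
  haveI hKM : IsMarkovKernel K :=
    ⟨fun p => by change IsProbabilityMeasure (Sg.kernel p.1.toNNReal p.2); infer_instance⟩
  have hK : ∀ (t : ℝ) (z : PhaseSpace N), K (t, z) = Sg.kernel t.toNNReal z := fun t z => rfl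
  refine ⟨K ∘ₖ (Kernel.const (PhaseSpace N) ρ ×ₖ Kernel.id), inferInstance, fun f hf hfc z =>
    Sg.integral_generator_comp_const_prod_id K hK (pinnedChain_contDiff_U ω₂ lam β γ)
      (pinnedChain_contDiff_V ω₂ lam β γ) hr hf hfc z, fun g => Sg.continuous_integral_comp_const_prod_id
      K hK ρ (continuous_act_pinnedChainSemigroup hω hl.le hβ.le hγ.le hN0 hTL.le hTR.le) g, ?_⟩
  -- (iii): time step `t* = 1/(8(C + r + 1))`, so that `a ≤ e^{C t*} (r t* + 1/2) ≤ (8/7)(5/8) < 1`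
  set Cst : ℝ := θ * γ * (T_L + T_R) with hCst
  have hCst0 : 0 ≤ Cst := by positivity
  set ts : ℝ := 1 / (8 * (Cst + r + 1)) with hts
  have hts0 : 0 < ts := by positivity
  have hkey : (Cst + r + 1) * ts = 1 / 8 := by rw [hts]; field_simp
  have hCts : Cst * ts ≤ 1 / 8 := hkey ▸ mul_le_mul_of_nonneg_right (by linarith) hts0.le
  have hrts : r * ts ≤ 1 / 8 := hkey ▸ mul_le_mul_of_nonneg_right (by linarith) hts0.le
  set tstar : ℝ≥0 := ⟨ts, hts0.le⟩
  have htsco : ((tstar : ℝ≥0) : ℝ) = ts := rfl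
  have hts0' : (0 : ℝ≥0) < tstar := by rw [← NNReal.coe_lt_coe]; exact hts0
  set V : PhaseSpace N → ℝ≥0∞ := fun y => ENNReal.ofReal (Real.exp (θ * P.hamiltonian N y)) with hV
  have hVm : Measurable V := ENNReal.measurable_ofReal.comp (Real.measurable_exp.comp
    ((pinnedChain_continuous_hamiltonian ω₂ lam β γ N).measurable.const_mul _))
  have h34 := lintegral_exp_mul_hamiltonian_pinnedChainSemigroup_le hω hl.le hβ.le hγ.le hN0 hTL.le
    hTR.le hTL hTR hθ hθ'
  -- H2 at `t*` with contraction `1/2` (CEHR Thm 5.1 in the tree; (3.4) below the level `E₀`)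
  obtain ⟨E₀, hE₀⟩ := pinnedChain_lintegral_exp_hamiltonian_small hω hl hβ hγ hN hTL hTR hθ hθ'
    (tstar := (tstar : ℝ)) (by rw [htsco]; exact hts0)
  set c₀ : ℝ := Real.exp (Cst * ts) * Real.exp (θ * E₀) with hc₀
  set a₀ : ℝ≥0∞ := ENNReal.ofReal (1 / 2) with ha₀
  have hH2 : ∀ x, ∫⁻ y, V y ∂(Sg.kernel tstar x) ≤ a₀ * V x + ENNReal.ofReal c₀ := by
    intro x
    change ∫⁻ y, V y ∂(P.transitionKernel N T_L T_R tstar x) ≤ _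
    by_cases hx : P.hamiltonian N x ≤ E₀
    · refine (h34 tstar x).trans (le_add_left (ENNReal.ofReal_le_ofReal ?_))
      rw [hc₀, htsco]
      exact mul_le_mul_of_nonneg_left (Real.exp_le_exp.2 (mul_le_mul_of_nonneg_left hx hθ.le))
        (Real.exp_pos _).le
    · rw [pinnedChain_lintegral_transitionKernel hω hl.le hβ.le hγ.le N T_L T_R tstar x hVm]
      refine (hE₀ x (le_of_not_ge hx)).trans (le_add_right (le_of_eq ?_))
      rw [ha₀, hV, ← ENNReal.ofReal_mul (by norm_num)]
      congr 1; ring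
  set c : ℝ≥0∞ := ENNReal.ofReal (Real.exp (Cst * ts)) with hc
  have hloc : ∀ u : ℝ≥0, u < tstar → ∀ x, ∫⁻ y, V y ∂(Sg.kernel u x) ≤ c * V x := by
    intro u hu x
    refine (h34 u x).trans ?_
    rw [hc, hV, ← ENNReal.ofReal_mul (by positivity)]
    refine ENNReal.ofReal_le_ofReal (mul_le_mul_of_nonneg_right (Real.exp_le_exp.2 ?_) (by positivity))
    have hu' : ((u : ℝ≥0) : ℝ) ≤ ts := by rw [← htsco]; exact_mod_cast hu.le
    rw [hCst]
    nlinarith [u.coe_nonneg]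
  -- the uniform orbit bound (3.5)–(3.6), and its sharpening past `t*`
  have ha₀1 : a₀ < 1 := ENNReal.ofReal_lt_one.2 (by norm_num)
  obtain ⟨B, hBtop, hB⟩ := MarkovSemigroup.exists_fixedBound ha₀1 ENNReal.ofReal_ne_top
  have hunif : ∀ (t : ℝ≥0) x, ∫⁻ y, V y ∂(Sg.kernel t x) ≤ c * V x + B := fun t x =>
    MarkovSemigroup.lintegral_kernel_le_of_lyapunov Sg.kernel Sg.kernel_zero Sg.kernel_add hVm hts0'
      ha₀1.le hB hH2 hloc t x
  refine ⟨c * ENNReal.ofReal (r * ts) + c * a₀, B + (c * ENNReal.ofReal c₀ + B), ?_, ?_, fun z => ?_⟩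
  · rw [hc, ha₀, ← ENNReal.ofReal_mul (Real.exp_pos _).le, ← ENNReal.ofReal_mul (Real.exp_pos _).le,
      ← ENNReal.ofReal_add (by positivity) (by positivity), ENNReal.ofReal_lt_one]
    have h1 : Real.exp (Cst * ts) * (1 - Cst * ts) ≤ 1 := by
      have := Real.add_one_le_exp (-(Cst * ts))
      calc Real.exp (Cst * ts) * (1 - Cst * ts) ≤ Real.exp (Cst * ts) * Real.exp (-(Cst * ts)) :=
            mul_le_mul_of_nonneg_left (by linarith) (Real.exp_pos _).le
        _ = 1 := by rw [← Real.exp_add, add_neg_cancel, Real.exp_zero]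
    nlinarith [Real.exp_pos (Cst * ts), mul_nonneg hCst0 hts0.le, mul_nonneg hr.le hts0.le]
  · exact ENNReal.add_ne_top.2 ⟨hBtop, ENNReal.add_ne_top.2
      ⟨ENNReal.mul_ne_top ENNReal.ofReal_ne_top ENNReal.ofReal_ne_top, hBtop⟩⟩
  · have h₁ : ∀ t : ℝ, ∫⁻ y, V y ∂(K (t, z)) ≤ c * V z + B := fun t => hunif t.toNNReal z
    have h₂ : ∀ t : ℝ, ts ≤ t →
        ∫⁻ y, V y ∂(K (t, z)) ≤ c * a₀ * V z + (c * ENNReal.ofReal c₀ + B) := fun t ht =>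
      Sg.lintegral_kernel_le_of_tstar_le K hK hVm hH2 hunif (by rw [htsco]; exact ht) z
    refine (lintegral_comp_const_prod_id_le K ρ z hVm ts h₁ h₂).trans ?_
    gcongr
    exact expMeasure_Iio_le hr hts0.le

end PinnedChain

end Literature.MathematicalPhysics.KineticTheory.HeatConduction
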